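import Literature.AlgebraicGeometry.GroupSchemes.HopfIdealOfFiniteSubgroupOfPoints
import Literature.AlgebraicGeometry.GroupSchemes.IsIsoOrEtaleOfNatCard
import Mathlib.RingTheory.Etale.Field
import HarnessLib

/-!
# An étale ideal is the ideal of its points; an étale closed subscheme of degree `#G(k)` is unique
# ([Tate1997FiniteFlatGroupSchemes] (3.7); [StacksProject] 00U3)

Topic `Literature/AlgebraicGeometry/GroupSchemes`; namespace `Literature.AlgebraicGeometry.GroupSchemes.EtaleIdealPoints`.  THEOREMS ONLY
(no definition, no instance, no notation, no named fact, no `sorry`).  Cell `hodgecm-mathlib` (D-0151), programme P6 «MOD» (crux hLiu418 =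
stmt-HodgeConjecture-24832, `--supports`, count-neutral): generic organ for the D-line `stub_DOWN` ∕ `stub_SPEC` road «SP-SURJ» (cut memo
`MEMO-DLINE-cut.v1.F0P6c-plan-g4` row G8: every admissible ideal of the `w`-block downstairs is a specialised line) — at an ORDINARY point the
`w`-block `𝒢 = 𝒢_x̄[ϖ]` has `#𝒢(k̄) = q` and, besides `kerFI` (connected), exactly ONE étale admissible ideal of corank `q`; this file proves the
UNIQUENESS half in the ★ Hopf-ideal ∕ points-ideal currency of `HopfIdealOfFiniteSubgroupOfPoints` (B-p12∕F0P6c organs) and `ptEquiv`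
(`AffineGroupSchemeHopfAlgebra`).  HC_CM is proved only modulo the printed citations until rung 0 closes; this file is generic and changes no count.

THE PRINT.  [StacksProject] Tag 00U3 ∕ [GortzWedhorn2023] proof of Prop. 27.188 (1): a finite étale scheme over a separably closed field is
constant — an étale `k`-algebra `B` is SPLIT, `B ≅ k^{Spec B}` (Mathlib `Algebra.FormallyEtale.equivPiOfIsSepClosed`), so its characters are the
coordinate projections, they separate elements, and they number `dim_k B`.  [Tate1997FiniteFlatGroupSchemes] (3.7): over `k = k̄`, `#G(k)·rk G⁰ =
rk G`; the reduced subscheme `G_red` is THE étale closed subgroup with all the points.  Consequently, for an affine `k`-scheme `G` with finitely many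
points and an ideal `I ⊂ Γ(G)` with `Γ(G) ⧸ I` étale: `I = ⋂ {ker φ_x : x ∈ V(I)(k)}`; and if `dim_k Γ(G)⧸I = #G(k)` then `V(I)(k) = G(k)` and
`I = ⋂_{x ∈ G(k)} ker φ_x` is the POINTS IDEAL of all of `G(k)` — in particular it is UNIQUE.

## Contents
* §1 (commutative algebra over a separably closed `k`; `I ⊂ A` with `A ⧸ I` étale): `mem_iff_forall_algHom_apply_eq_zero` (`a ∈ I ↔` every
  character killing `I` kills `a`), `exists_injective_algHom_of_etale` (an injective family of `dim_k (A⧸I)` characters killing `I` through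
  which every such character factors — the projections of the split algebra; a character of `k^n` is an evaluation, by idempotents).
* §2 `le_ker_of_etale_of_natCard_eq` (if `dim_k (A ⧸ I) = #Hom_k(A, k)` then EVERY character kills `I`), **`eq_ker_pi_of_etale_of_natCard_eq`**
  (`I = ker (ψ)_ψ`, the ideal of all points), **`eq_of_etale_of_natCard_eq`** (uniqueness).
* §3 scheme currency for `G : SchemeOver k` finite over `k`: `algebraEtale_of_etale_specOver_quotient` (the ★ DICT predicate
  `IdealIsEtale G I := Etale (Spec (Γ(G)⧸I) → Spec k)` ⇒ `Algebra.Etale k (Γ(G)⧸I)`), `natCard_specOver_hom_eq_natCard_algHom`,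
  `finite_algHom_of_isFinite`, **`eq_ker_pi_ptEquiv_of_etale_of_natCard_eq`** (`I =` the ★ points ideal `ker (ptEquiv x)_{x : Spec k → G}`),
  `le_ker_ptEquiv_of_etale_of_natCard_eq` (every point factors through `V(I)`), **`eq_of_etale_of_finrank_eq_natCard_sections`** ∕ `…_specOver`
  (UNIQUENESS, counts in sections `𝟙_ ⟶ G` as in ★ (K-b) `eq_or_etale_of_isHopfIdeal_of_stable`'s `hpts`, or in points `Spec k → G`).

## References
* [Tate1997FiniteFlatGroupSchemes] J. Tate, *Finite flat group schemes*, in: Modular Forms and Fermat's Last Theorem (1997), (3.7).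
* [StacksProject] The Stacks Project, Tag 00U3 (étale algebras over separably closed fields split).
* [GortzWedhorn2023] U. Görtz, T. Wedhorn, *Algebraic Geometry II* (2023), §(27.2) (p. 606); Prop. 27.188 (1), proof.
* [GortzWedhorn2020] U. Görtz, T. Wedhorn, *Algebraic Geometry I*, 2nd ed. (2020), Section (4.7).
-/

set_option autoImplicit false

-- Mathlib's `Over`/`Scheme` APIs are stated across semireducible wrappers (as in the ★ `GroupSchemes/*` files).
set_option backward.isDefEq.respectTransparency false

universe u

open CategoryTheory CategoryTheory.Limits AlgebraicGeometry MonoidalCategory CartesianMonoidalCategory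

noncomputable section

namespace Literature.AlgebraicGeometry.GroupSchemes

namespace EtaleIdealPoints

/-! ## §1 Commutative algebra: an étale quotient over a separably closed field is cut out by its characters -/

section Algebra

variable {k : Type u} [Field k] [IsSepClosed k] {A : Type u} [CommRing A] [Algebra k A] (I : Ideal A)
  [Algebra.Etale k (A ⧸ I)]

/-- For `B := A ⧸ I` étale over the separably closed field `k`: the split isomorphism `B ≃ₐ[k] k^{Spec B}` (Mathlib
`Algebra.FormallyEtale.equivPiOfIsSepClosed`) yields, for each prime `p` of `B`, a character `χ_p : A →ₐ[k] k` killing `I`, and these characters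
JOINTLY DETECT membership in `I`: `a ∈ I ↔ ∀ χ : A →ₐ[k] k, I ≤ ker χ → χ a = 0`. [cite: StacksProject, Tag 00U3] [cite: GortzWedhorn2023, Prop. 27.188 (1), proof] -/
theorem mem_iff_forall_algHom_apply_eq_zero (a : A) :
    a ∈ I ↔ ∀ χ : A →ₐ[k] k, I ≤ RingHom.ker χ.toRingHom → χ a = 0 := by
  refine ⟨fun ha χ hχ => ?_, fun h => ?_⟩
  · exact hχ ha
  · let e := Algebra.FormallyEtale.equivPiOfIsSepClosed k (A ⧸ I)
    have hzero : e (Ideal.Quotient.mk I a) = 0 := by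
      funext p
      let χ : A →ₐ[k] k := ((Pi.evalAlgHom k (fun _ : PrimeSpectrum (A ⧸ I) => k) p).comp e.toAlgHom).comp (Ideal.Quotient.mkₐ k I)
      have hχ : I ≤ RingHom.ker χ.toRingHom := fun x hx => by
        rw [RingHom.mem_ker, AlgHom.toRingHom_eq_coe, AlgHom.coe_toRingHom]
        change e (Ideal.Quotient.mk I x) p = 0
        rw [Ideal.Quotient.eq_zero_iff_mem.2 hx, map_zero, Pi.zero_apply]
      exact h χ hχ
    rw [← Ideal.Quotient.eq_zero_iff_mem]
    exact e.injective (hzero.trans (map_zero e).symm)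

/-- The characters of `A` killing an étale `I` are `dim_k (A ⧸ I)` in number: `#{χ : A →ₐ[k] k | I ≤ ker χ} = dim_k (A ⧸ I)` — the characters of
the split algebra `A ⧸ I ≅ k^{Spec(A⧸I)}` are the coordinate projections. Stated as: there is an INJECTIVE family `χ : Spec (A ⧸ I) → (A →ₐ[k] k)` of
characters killing `I`, with `#Spec (A ⧸ I) = dim_k (A ⧸ I)`, through which every character killing `I` factors.
[cite: StacksProject, Tag 00U3] [cite: GortzWedhorn2023, Prop. 27.188 (1), proof] -/
theorem exists_injective_algHom_of_etale :
    ∃ χ : PrimeSpectrum (A ⧸ I) → (A →ₐ[k] k), Function.Injective χ ∧ (∀ p, I ≤ RingHom.ker (χ p).toRingHom) ∧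
      (∀ ψ : A →ₐ[k] k, I ≤ RingHom.ker ψ.toRingHom → ∃ p, χ p = ψ) ∧
      Nat.card (PrimeSpectrum (A ⧸ I)) = Module.finrank k (A ⧸ I) := by
  classical
  let e := Algebra.FormallyEtale.equivPiOfIsSepClosed k (A ⧸ I)
  haveI : Module.Finite k (A ⧸ I) := Algebra.FormallyUnramified.finite_of_free k (A ⧸ I)
  haveI : IsArtinianRing (A ⧸ I) := isArtinian_of_tower k inferInstance
  haveI : Fintype (PrimeSpectrum (A ⧸ I)) := Fintype.ofFinite _
  let χ' : PrimeSpectrum (A ⧸ I) → (A ⧸ I →ₐ[k] k) := fun p => (Pi.evalAlgHom k (fun _ : PrimeSpectrum (A ⧸ I) => k) p).comp e.toAlgHom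
  have hχ' : ∀ p b, χ' p b = e b p := fun p b => rfl
  refine ⟨fun p => (χ' p).comp (Ideal.Quotient.mkₐ k I), fun p q hpq => ?_, fun p x hx => ?_, fun ψ hψ => ?_, ?_⟩
  · -- injective: test against `e⁻¹ (single p 1)`
    by_contra hne
    obtain ⟨b, hb⟩ := Ideal.Quotient.mk_surjective (I := I) (e.symm (Pi.single p 1))
    have h := AlgHom.congr_fun hpq b
    simp only [AlgHom.comp_apply, Ideal.Quotient.mkₐ_eq_mk, hb, hχ', AlgEquiv.apply_symm_apply, Pi.single_eq_same,
      Pi.single_eq_of_ne (Ne.symm hne)] at h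
    exact one_ne_zero h
  · rw [RingHom.mem_ker, AlgHom.toRingHom_eq_coe, AlgHom.coe_toRingHom, AlgHom.comp_apply, Ideal.Quotient.mkₐ_eq_mk,
      Ideal.Quotient.eq_zero_iff_mem.2 hx, map_zero]
  · -- every character killing `I` factors through `A ⧸ I ≅ k^Spec`, hence is a projection
    let ψ' : A ⧸ I →ₐ[k] k := Ideal.Quotient.liftₐ I ψ fun a ha => hψ ha
    let φ : (PrimeSpectrum (A ⧸ I) → k) →ₐ[k] k := ψ'.comp e.symm.toAlgHom
    -- a character of `k^n` is an evaluation
    obtain ⟨p, hp⟩ : ∃ p, φ = Pi.evalAlgHom k (fun _ : PrimeSpectrum (A ⧸ I) => k) p := by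
      have key : ∃ p, φ (Pi.single p 1) ≠ 0 := by
        by_contra hall
        simp only [not_exists, ne_eq, not_not] at hall
        have h1 : φ 1 = 1 := map_one φ
        have hsum : (1 : PrimeSpectrum (A ⧸ I) → k) = ∑ p, Pi.single p 1 := by
          ext q; simp [Finset.sum_apply, Pi.single_apply]
        rw [hsum, map_sum] at h1
        simp only [hall, Finset.sum_const_zero] at h1
        exact zero_ne_one h1
      obtain ⟨p, hp⟩ := key
      refine ⟨p, ?_⟩
      -- `φ (single p 1)` is an idempotent `≠ 0` of the field `k`, so `= 1`; and `φ (single q 1) = 0` for `q ≠ p`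
      have hid : φ (Pi.single p 1) * φ (Pi.single p 1) = φ (Pi.single p 1) := by
        rw [← map_mul]; congr 1; ext q; by_cases hq : q = p <;> simp [hq]
      have hp1 : φ (Pi.single p 1) = 1 := by
        rcases mul_eq_zero.1 (show φ (Pi.single p 1) * (φ (Pi.single p 1) - 1) = 0 by rw [mul_sub, hid, mul_one, sub_self]) with h | h
        · exact absurd h hp
        · exact sub_eq_zero.1 h
      have hq0 : ∀ q, q ≠ p → φ (Pi.single q 1) = 0 := fun q hq => by
        have h0 : φ (Pi.single q 1) * φ (Pi.single p 1) = 0 := by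
          rw [← map_mul]
          have : (Pi.single q 1 : PrimeSpectrum (A ⧸ I) → k) * Pi.single p 1 = 0 := by
            ext r; by_cases hr : r = p <;> simp [Pi.single_apply, hr, hq]
          rw [this, map_zero]
        rwa [hp1, mul_one] at h0
      apply AlgHom.toLinearMap_injective
      apply (Pi.basisFun k (PrimeSpectrum (A ⧸ I))).ext
      intro q
      simp only [AlgHom.toLinearMap_apply, Pi.basisFun_apply, Pi.evalAlgHom_apply]
      by_cases hq : q = p
      · subst hq; rw [hp1, Pi.single_eq_same]
      · rw [hq0 q hq, Pi.single_eq_of_ne' hq]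
    refine ⟨p, ?_⟩
    apply AlgHom.ext
    intro a
    have h1 : ψ a = ψ' (Ideal.Quotient.mk I a) := rfl
    have h2 : ψ' (Ideal.Quotient.mk I a) = φ (e (Ideal.Quotient.mk I a)) := by
      simp only [φ, AlgHom.comp_apply, AlgEquiv.coe_toAlgHom, AlgEquiv.symm_apply_apply]
    rw [AlgHom.comp_apply, Ideal.Quotient.mkₐ_eq_mk, hχ', h1, h2, hp, Pi.evalAlgHom_apply]
  · rw [Nat.card_eq_fintype_card, ← Module.finrank_pi k (ι := PrimeSpectrum (A ⧸ I)), ← e.toLinearEquiv.finrank_eq]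

end Algebra

/-! ## §2 All characters kill an étale ideal of corank `#Hom_k(A, k)`; such an ideal is the ideal of ALL points, hence unique -/

section AllPoints

variable {k : Type u} [Field k] [IsSepClosed k] {A : Type u} [CommRing A] [Algebra k A]

/-- **If `A ⧸ I` is étale of `k`-dimension `#Hom_k(A, k)` (finite), EVERY character of `A` kills `I`**: the `dim_k (A ⧸ I)` characters through
`A ⧸ I` (§1) exhaust `Hom_k(A, k)` by counting. [cite: StacksProject, Tag 00U3] [cite: Tate1997FiniteFlatGroupSchemes, (3.7)] -/
theorem le_ker_of_etale_of_natCard_eq (I : Ideal A) [Algebra.Etale k (A ⧸ I)] [Finite (A →ₐ[k] k)]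
    (hcard : Nat.card (A →ₐ[k] k) = Module.finrank k (A ⧸ I)) (ψ : A →ₐ[k] k) : I ≤ RingHom.ker ψ.toRingHom := by
  obtain ⟨χ, hinj, hker, -, hc⟩ := EtaleIdealPoints.exists_injective_algHom_of_etale (k := k) I
  have hbij : Function.Bijective χ := (Nat.bijective_iff_injective_and_card χ).2 ⟨hinj, by rw [hc, hcard]⟩
  obtain ⟨p, rfl⟩ := hbij.2 ψ
  exact hker p

/-- **An étale ideal of corank `#Hom_k(A, k)` is the ideal of ALL `k`-points** `⋂_ψ ker ψ = ker (ψ)_ψ`.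
[cite: StacksProject, Tag 00U3] [cite: Tate1997FiniteFlatGroupSchemes, (3.7)] -/
theorem eq_ker_pi_of_etale_of_natCard_eq (I : Ideal A) [Algebra.Etale k (A ⧸ I)] [Finite (A →ₐ[k] k)]
    (hcard : Nat.card (A →ₐ[k] k) = Module.finrank k (A ⧸ I)) :
    I = RingHom.ker (AlgHom.pi fun ψ : (A →ₐ[k] k) => ψ : A →ₐ[k] ((A →ₐ[k] k) → k)).toRingHom := by
  apply le_antisymm
  · intro a ha
    rw [RingHom.mem_ker, AlgHom.toRingHom_eq_coe, AlgHom.coe_toRingHom]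
    funext ψ
    rw [AlgHom.pi_apply, Pi.zero_apply]
    exact le_ker_of_etale_of_natCard_eq I hcard ψ ha
  · intro a ha
    rw [RingHom.mem_ker, AlgHom.toRingHom_eq_coe, AlgHom.coe_toRingHom] at ha
    refine (EtaleIdealPoints.mem_iff_forall_algHom_apply_eq_zero (k := k) I a).2 fun ψ _ => ?_
    have := congr_fun ha ψ
    rwa [AlgHom.pi_apply] at this

/-- **UNIQUENESS OF THE ÉTALE IDEAL OF CORANK `#Hom_k(A, k)`**: two ideals with étale quotients of `k`-dimension `#Hom_k(A, k)` coincide (both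
are the ideal of all points). [cite: StacksProject, Tag 00U3] [cite: Tate1997FiniteFlatGroupSchemes, (3.7)] -/
theorem eq_of_etale_of_natCard_eq (I₁ I₂ : Ideal A) [Algebra.Etale k (A ⧸ I₁)] [Algebra.Etale k (A ⧸ I₂)] [Finite (A →ₐ[k] k)]
    (h₁ : Nat.card (A →ₐ[k] k) = Module.finrank k (A ⧸ I₁)) (h₂ : Nat.card (A →ₐ[k] k) = Module.finrank k (A ⧸ I₂)) : I₁ = I₂ :=
  (eq_ker_pi_of_etale_of_natCard_eq I₁ h₁).trans (eq_ker_pi_of_etale_of_natCard_eq I₂ h₂).symm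

end AllPoints

/-! ## §3 Scheme currency: affine `k`-schemes, `Etale (Spec (Γ(G) ⧸ I) → Spec k)`, points `Spec k → G` and sections `𝟙_ ⟶ G` -/

section Scheme

open Literature.AlgebraicGeometry.Motives AffineGroupScheme

variable {k : Type u} [Field k] (G : SchemeOver k)

/-- `Spec (Γ(G) ⧸ I) → Spec k` étale (the ★ DICT predicate `IdealIsEtale`) means `Γ(G) ⧸ I` is an étale `k`-algebra (Mathlib
`HasRingHomProperty.Spec_iff`). [cite: GortzWedhorn2020, Section (4.7)] -/
theorem algebraEtale_of_etale_specOver_quotient (I : Ideal (Alg G)) (hI : Etale (specOver k (Alg G ⧸ I)).hom) :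
    Algebra.Etale k (Alg G ⧸ I) := by
  have h : Etale (Spec.map (CommRingCat.ofHom (algebraMap k (Alg G ⧸ I)))) := hI
  rwa [HasRingHomProperty.Spec_iff (P := @Etale), CommRingCat.hom_ofHom, RingHom.etale_algebraMap] at h

/-- Points `Spec k → G` over `k` are in bijection with characters of `Γ(G)` (★ `ptEquiv`), so they have the same cardinality.
[cite: GortzWedhorn2023, §(27.2) (p. 606)] -/
theorem natCard_specOver_hom_eq_natCard_algHom [IsAffine G.left] : Nat.card (specOver k k ⟶ G) = Nat.card (Alg G →ₐ[k] k) :=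
  Nat.card_congr (ptEquiv G k)

/-- A scheme FINITE over a field has finitely many characters `Γ(G) → k` (distinct characters are linearly independent in the
finite-dimensional dual, Dedekind). [cite: GortzWedhorn2023, §(27.2) (p. 606)] -/
theorem finite_algHom_of_isFinite [IsFinite G.hom] : Finite (Alg G →ₐ[k] k) := by
  haveI : Module.Finite k (Alg G) := Alg.moduleFinite G
  exact (linearIndependent_algHom_toLinearMap k (Alg G) k).finite

variable [IsAffine G.left] [IsSepClosed k] [IsFinite G.hom]

/-- **AN ÉTALE IDEAL OF CORANK `#G(k)` IS THE IDEAL OF ALL `k`-POINTS OF `G`** (the ★ points ideal `ker (ptEquiv x)_{x ∈ G(k)}` of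
`HopfIdealOfFiniteSubgroupOfPoints`, for the family of ALL points): for `G` finite over a separably closed field `k` and `I ⊂ Γ(G)` with
`Spec (Γ(G) ⧸ I) → Spec k` étale of degree `#G(k)`. [cite: StacksProject, Tag 00U3] [cite: Tate1997FiniteFlatGroupSchemes, (3.7)] -/
theorem eq_ker_pi_ptEquiv_of_etale_of_natCard_eq (I : Ideal (Alg G)) (hI : Etale (specOver k (Alg G ⧸ I)).hom)
    (hcard : Nat.card (specOver k k ⟶ G) = Module.finrank k (Alg G ⧸ I)) :
    I = RingHom.ker (AlgHom.pi fun x : (specOver k k ⟶ G) => ptEquiv G k x : Alg G →ₐ[k] ((specOver k k ⟶ G) → k)).toRingHom := by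
  haveI := algebraEtale_of_etale_specOver_quotient G I hI
  haveI : Finite (Alg G →ₐ[k] k) := finite_algHom_of_isFinite G
  rw [natCard_specOver_hom_eq_natCard_algHom] at hcard
  rw [eq_ker_pi_of_etale_of_natCard_eq I hcard]
  ext a
  simp only [RingHom.mem_ker, AlgHom.toRingHom_eq_coe, AlgHom.coe_toRingHom, funext_iff, AlgHom.pi_apply, Pi.zero_apply]
  exact ⟨fun h x => h (ptEquiv G k x), fun h ψ => by simpa only [Equiv.apply_symm_apply] using h ((ptEquiv G k).symm ψ)⟩

/-- **EVERY `k`-POINT OF `G` LIES ON AN ÉTALE CLOSED SUBSCHEME OF DEGREE `#G(k)`**: `I ≤ ker (ptEquiv x)` for all `x : Spec k → G`, i.e. `x`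
factors through `Spec (Γ(G) ⧸ I) ↪ G` (★ `exists_comp_quotIncl_eq_iff_le_ker`). [cite: StacksProject, Tag 00U3] [cite: Tate1997FiniteFlatGroupSchemes, (3.7)] -/
theorem le_ker_ptEquiv_of_etale_of_natCard_eq (I : Ideal (Alg G)) (hI : Etale (specOver k (Alg G ⧸ I)).hom)
    (hcard : Nat.card (specOver k k ⟶ G) = Module.finrank k (Alg G ⧸ I)) (x : specOver k k ⟶ G) :
    I ≤ RingHom.ker (ptEquiv G k x).toRingHom := by
  haveI := algebraEtale_of_etale_specOver_quotient G I hI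
  haveI : Finite (Alg G →ₐ[k] k) := finite_algHom_of_isFinite G
  rw [natCard_specOver_hom_eq_natCard_algHom] at hcard
  exact le_ker_of_etale_of_natCard_eq I hcard (ptEquiv G k x)

/-- **UNIQUENESS OF THE ÉTALE CLOSED SUBSCHEME OF DEGREE `#G(k)`** (sections currency `𝟙_ ⟶ G`, as in the ★ dichotomy (K-b) hypothesis
`#G(k) ∈ {1, q}`): for `G` finite over a separably closed field, two ideals `I₁, I₂ ⊂ Γ(G)` with `Spec (Γ(G) ⧸ Iᵢ) → Spec k` étale of degree
`#(𝟙_ ⟶ G)` are EQUAL.  In the P6 HEART: at an ordinary point the étale admissible ideal of the `w`-block (corank `q = #𝒢(k̄)`) is unique —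
every line other than the canonical one specialises to it. [cite: Tate1997FiniteFlatGroupSchemes, (3.7)] [cite: StacksProject, Tag 00U3] -/
theorem eq_of_etale_of_finrank_eq_natCard_sections (I₁ I₂ : Ideal (Alg G))
    (h₁ : Etale (specOver k (Alg G ⧸ I₁)).hom) (h₂ : Etale (specOver k (Alg G ⧸ I₂)).hom)
    (hc₁ : Module.finrank k (Alg G ⧸ I₁) = Nat.card (𝟙_ (SchemeOver k) ⟶ G))
    (hc₂ : Module.finrank k (Alg G ⧸ I₂) = Nat.card (𝟙_ (SchemeOver k) ⟶ G)) : I₁ = I₂ := by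
  haveI := algebraEtale_of_etale_specOver_quotient G I₁ h₁
  haveI := algebraEtale_of_etale_specOver_quotient G I₂ h₂
  haveI : Finite (Alg G →ₐ[k] k) := finite_algHom_of_isFinite G
  have hs : Nat.card (𝟙_ (SchemeOver k) ⟶ G) = Nat.card (Alg G →ₐ[k] k) := natCard_sections_eq_natCard_algHom G
  exact eq_of_etale_of_natCard_eq I₁ I₂ (by rw [← hs, hc₁]) (by rw [← hs, hc₂])

/-- The same in points currency `Spec k → G` over `k`. [cite: Tate1997FiniteFlatGroupSchemes, (3.7)] [cite: StacksProject, Tag 00U3] -/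
theorem eq_of_etale_of_finrank_eq_natCard_specOver (I₁ I₂ : Ideal (Alg G))
    (h₁ : Etale (specOver k (Alg G ⧸ I₁)).hom) (h₂ : Etale (specOver k (Alg G ⧸ I₂)).hom)
    (hc₁ : Module.finrank k (Alg G ⧸ I₁) = Nat.card (specOver k k ⟶ G))
    (hc₂ : Module.finrank k (Alg G ⧸ I₂) = Nat.card (specOver k k ⟶ G)) : I₁ = I₂ := by
  haveI := algebraEtale_of_etale_specOver_quotient G I₁ h₁
  haveI := algebraEtale_of_etale_specOver_quotient G I₂ h₂
  haveI : Finite (Alg G →ₐ[k] k) := finite_algHom_of_isFinite G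
  rw [natCard_specOver_hom_eq_natCard_algHom] at hc₁ hc₂
  exact eq_of_etale_of_natCard_eq I₁ I₂ hc₁.symm hc₂.symm

end Scheme

end EtaleIdealPoints

end Literature.AlgebraicGeometry.GroupSchemes

end
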